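import Mathlib
import Literature.NumberTheory.Transcendental.LindemannWeierstrassMeasureHolds
import Literature.Barriers.Schanuel.LargeTranscendenceDegreeHolds
import Literature.Barriers.Schanuel.LargeTranscendenceDegreeProofs
import Literature.NumberTheory.Transcendental.DiazGrid
import Summits.Schanuel.Schanuel.Theorems.RigidCoreSchanuelOnLogFreeCoreDiazAnyBase
import Summits.Schanuel.Schanuel.Theorems.RigidCoreSchanuelOnLogFreeCoreCalibrationR

/-!
# The Technical Hypothesis for the powers of `e^β` (`β` algebraic) and Diaz's Theorem 2.7 on the
# `e^β`-power grid (stubs `stub_expAlgPowersTH`, `stub_expAlgGridBound` of line `sector-split`)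

Registered calibration stubs C17 `stub_expAlgPowersTH` and C18 `stub_expAlgGridBound` of line
`sector-split` (skeleton v22, lead c11) of crux `stmt-Schanuel-0970`
(`Summit.Schanuel.Schanuel.Theses.RigidCore.SchanuelOnLogFreeCore`, (R): Schanuel's conjecture for
`ℚ`-linearly independent tuples of the log-free core `C_EA`).

A CALIBRATION of (R), off the path to the crux: the generalisation from the core point `e`
(`RigidCoreSchanuelOnLogFreeCoreExpOnePowersTH.lean`, Nesterenko–Waldschmidt's measure of `e`) to the
infinitely many core points `e^β`, `β ∈ ℚ̄ ∖ 0`.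

* `ExpAlgPowers.norm_linearForm_exp_pow_lowerBound` — a **polynomial lower bound for integer linear
  forms in `1, e^β, …, e^{(d−1)β}`**: `c ≤ (∑ᵢ |hᵢ|)^k · |∑_{i<d} hᵢ e^{iβ}|` for all non-zero `h ∈ ℤ^d`.
  Source: the measure of algebraic independence of M. Ably (1994) in ONE variable — for `β ≠ 0`
  algebraic, `|P(e^β)| ≥ exp(−c₂ D (log H + exp(C D log(D+1))))` for every non-zero `P ∈ ℤ[X₀]`
  of total degree `≤ D` and naive height `≤ H` — PROVED in the tree
  (`Literature.NumberTheory.Transcendental.Ably1994_lindemannWeierstrass_measure_holds`, `n = 1`);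
  for fixed `D` this is `A(D) · H^{−c₂D}`, polynomial in `H`.
* `stub_expAlgPowersTH` (registered signature verbatim) — the **Technical Hypothesis** (LNM 1752, Ch. 14,
  Def. 2.6) for `(1, e^β, …, e^{(d−1)β})`, every non-zero algebraic `β` (`TechnicalHypothesis.of_lowerBound`).
* `stub_expAlgGridBound` (registered signature verbatim) — **Diaz's Theorem 2.7, clause `t₂`** (PROVED
  in the tree, `Literature.Barriers.Schanuel.ceil_le_trdeg_gridField₂`) UNCONDITIONAL on the grid
  `x = (e^{iβ})_{i<d}`, `y = (e^{jβ})_{j<ℓ}`: for `d + ℓ < dℓ`,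
  `⌈dℓ/(d+ℓ)⌉ ≤ trdeg_ℚ ℚ(e^β, exp(e^{kβ}) : k ≤ d + ℓ − 2)`.
  E.g. `(d, ℓ) = (4, 5)`: **for every non-zero algebraic `β`, three of `e^β, e, e^{e^β}, e^{e^{2β}}, …,
  e^{e^{7β}}` are algebraically independent** (Lindemann–Weierstrass alone gives two, `e^β ⊥ e`, for
  `β ∉ ℚ`, and one for `β ∈ ℚ`; all `e^{kβ}` are powers of `e^β`).  The (R)-cells are the `ℚ`-free core tuples `(1, e^β, e^{2β}, …, e^{(N−1)β})`
  (demand `N`; `ExpAlgPowers.cruxCell`).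

Auxiliaries in the sub-namespace `…RigidCore.ExpAlgPowers`; only the two registered stubs are declared
directly in `Summit.Schanuel.Schanuel.Theorems.RigidCore`.  No definitions.

## References

* M. Ably, *Formes linéaires de logarithmes de points algébriques sur une courbe elliptique de type CM*
  / measure of algebraic independence for values of the exponential, Acta Arith. 67 (1994), Théorème
  p. 30 — entering only through the tree theorem `Ably1994_lindemannWeierstrass_measure_holds`. [Ably1994]
* Yu. V. Nesterenko, P. Philippon (eds.), *Introduction to Algebraic Independence Theory*, LNM 1752,
  Springer (2001), Ch. 14, Definition 2.6 and Theorem 2.7. [NesterenkoPhilippon2001]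
-/

noncomputable section

namespace Summit.Schanuel.Schanuel.Theorems.RigidCore

namespace ExpAlgPowers

open MvPolynomial

/-! ### The one-variable polynomial `Q_h = ∑ hₖ X₀^k ∈ ℤ[X₀]` of a coefficient vector `h ∈ ℤ^d` -/

/-- Coefficients of `Q_h = ∑_{k<d} h_k X₀^k` are bounded by `∑ |h_k|` (triangle inequality on the
sum of monomials; no injectivity needed). [folklore] -/
theorem abs_coeff_sum_monomial_le {d : ℕ} (h : Fin d → ℤ) (m : Fin 1 →₀ ℕ) :
    |coeff m (∑ k : Fin d, monomial (Finsupp.single (0 : Fin 1) (k : ℕ)) (h k))| ≤ ∑ k, |h k| := by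
  rw [coeff_sum]
  refine (Finset.abs_sum_le_sum_abs _ _).trans (Finset.sum_le_sum fun k _ => ?_)
  rw [coeff_monomial]
  split_ifs <;> simp

/-- The coefficient of `Q_h` at `X₀^l` is `h_l`. [folklore] -/
theorem coeff_sum_monomial_single {d : ℕ} (h : Fin d → ℤ) (l : Fin d) :
    coeff (Finsupp.single (0 : Fin 1) (l : ℕ))
      (∑ k : Fin d, monomial (Finsupp.single (0 : Fin 1) (k : ℕ)) (h k)) = h l := by
  rw [coeff_sum, Finset.sum_eq_single l]
  · simp
  · intro b _ hb
    rw [coeff_monomial, if_neg]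
    intro e
    exact hb (Fin.ext (Finsupp.single_injective _ e))
  · intro hl; exact absurd (Finset.mem_univ l) hl

/-- `Q_h ≠ 0` for `h ≠ 0`. [folklore] -/
theorem sum_monomial_ne_zero {d : ℕ} {h : Fin d → ℤ} (hh : h ≠ 0) :
    (∑ k : Fin d, monomial (Finsupp.single (0 : Fin 1) (k : ℕ)) (h k)) ≠ 0 := by
  obtain ⟨l, hl⟩ : ∃ l, h l ≠ 0 := Function.ne_iff.mp hh
  intro e
  apply hl
  rw [← coeff_sum_monomial_single h l, e, coeff_zero]

/-- `Q_h` has total degree `≤ d`. [folklore] -/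
theorem totalDegree_sum_monomial_le {d : ℕ} (h : Fin d → ℤ) :
    (∑ k : Fin d, monomial (Finsupp.single (0 : Fin 1) (k : ℕ)) (h k)).totalDegree ≤ d := by
  refine (totalDegree_finsetSum _ _).trans (Finset.sup_le fun k _ => ?_)
  refine (totalDegree_monomial_le _ _).trans ?_
  rw [Finsupp.sum_single_index rfl]
  exact k.is_lt.le

/-- `Q_h(z) = ∑ h_k z^k`. [folklore] -/
theorem aeval_sum_monomial {d : ℕ} (h : Fin d → ℤ) (z : ℂ) :
    aeval (fun _ : Fin 1 => z) (∑ k : Fin d, monomial (Finsupp.single (0 : Fin 1) (k : ℕ)) (h k)) =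
      ∑ k, (h k : ℂ) * z ^ (k : ℕ) := by
  simp only [map_sum, aeval_monomial, algebraMap_int_eq, eq_intCast]
  refine Finset.sum_congr rfl fun k _ => ?_
  rw [Finsupp.prod_single_index (by simp)]

/-! ### Ably's measure as a polynomial lower bound -/

/-- **Polynomial lower bound for integer linear forms in `1, e^β, …, e^{(d−1)β}`** (`β ≠ 0` algebraic),
the input of `TechnicalHypothesis.of_lowerBound`: there are `c > 0` and `k ∈ ℕ` with
`c ≤ (∑ᵢ |hᵢ|)^k · |∑_{i<d} hᵢ (e^β)ⁱ|` for every non-zero `h ∈ ℤ^d`.  Proof: `Q_h = ∑ hᵢ X₀ⁱ ≠ 0` has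
total degree `≤ d` and height `≤ H = ∑|hᵢ|`, so Ably's measure (one variable, degree `D = d`) gives
`|Q_h(e^β)| ≥ exp(−c₂ d (log H + E)) = exp(−c₂ d E) · H^{−c₂ d}`, `E = exp(C d log(d+1))`; take
`k = ⌈c₂ d⌉`, `c = exp(−c₂ d E)`. [cite: Ably1994, Théorème p. 30] -/
theorem norm_linearForm_exp_pow_lowerBound {β : ℂ} (hβ : IsAlgebraic ℚ β) (hβ0 : β ≠ 0) (d : ℕ) :
    ∃ c : ℝ, 0 < c ∧ ∃ k : ℕ, ∀ h : Fin d → ℤ, h ≠ 0 →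
      c ≤ (∑ i, |(h i : ℝ)|) ^ k * ‖∑ i, (h i : ℂ) * (Complex.exp β) ^ (i : ℕ)‖ := by
  rcases Nat.eq_zero_or_pos d with rfl | hd
  · exact ⟨1, one_pos, 0, fun h hh => (hh (Subsingleton.elim _ _)).elim⟩
  -- Ably's measure for the single exponential `e^β`
  have hli : LinearIndependent ℚ (fun _ : Fin 1 => β) := by
    rw [Fintype.linearIndependent_iff]
    intro g hg i
    rw [Fin.sum_univ_one] at hg
    have := smul_eq_zero.mp hg
    rw [Subsingleton.elim i 0]
    exact this.resolve_right hβ0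
  obtain ⟨C, c₂, -, hc₂, hA⟩ :=
    Literature.NumberTheory.Transcendental.Ably1994_lindemannWeierstrass_measure_holds 1
      (fun _ => β) (fun _ => hβ) hli
  set E : ℝ := Real.exp (C * (d : ℝ) ^ 1 * Real.log ((d : ℝ) + 1)) with hE
  refine ⟨Real.exp (-(c₂ * (d : ℝ) ^ 1 * E)), Real.exp_pos _, ⌈c₂ * d⌉₊, fun h hh => ?_⟩
  set K : ℕ := ⌈c₂ * d⌉₊ with hK
  set Q : MvPolynomial (Fin 1) ℤ := ∑ k : Fin d, monomial (Finsupp.single (0 : Fin 1) (k : ℕ)) (h k)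
    with hQ
  set H : ℕ := ∑ i, (h i).natAbs with hH
  -- the height `H = ∑ |hᵢ| ≥ 1`
  have hHZ : (H : ℤ) = ∑ i, |h i| := by
    rw [hH]; push_cast [Int.natCast_natAbs]; rfl
  have hHR : (H : ℝ) = ∑ i, |(h i : ℝ)| := by
    have : ((H : ℤ) : ℝ) = ((∑ i, |h i| : ℤ) : ℝ) := by rw [hHZ]
    push_cast at this
    exact this
  have hH1 : 1 ≤ H := by
    obtain ⟨i, hi⟩ : ∃ i, h i ≠ 0 := Function.ne_iff.mp hh
    have h1 : 1 ≤ (h i).natAbs := Int.natAbs_pos.mpr hi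
    exact h1.trans (Finset.single_le_sum (f := fun j => (h j).natAbs) (fun j _ => Nat.zero_le _)
      (Finset.mem_univ i))
  have hHpos : (0 : ℝ) < H := by exact_mod_cast hH1
  have hcoeff : ∀ m, |Q.coeff m| ≤ (H : ℤ) := fun m => by
    rw [hHZ]; exact abs_coeff_sum_monomial_le h m
  have hmain := hA Q d H (sum_monomial_ne_zero hh) (totalDegree_sum_monomial_le h) hcoeff
  rw [aeval_sum_monomial] at hmain
  -- split the bound: `exp(-(c₂ d (log H + E))) = exp(-c₂ d E) · exp(-c₂ d log H)`
  have hsplit : Real.exp (-(c₂ * (d : ℝ) ^ 1 * (Real.log H + E))) =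
      Real.exp (-(c₂ * (d : ℝ) ^ 1 * E)) * Real.exp (-(c₂ * d * Real.log H)) := by
    rw [← Real.exp_add]
    congr 1
    ring
  rw [hsplit] at hmain
  -- `H^K · H^{-c₂ d} ≥ 1`
  have hHK : (1 : ℝ) ≤ (H : ℝ) ^ K * Real.exp (-(c₂ * d * Real.log H)) := by
    have hlogH : 0 ≤ Real.log H := Real.log_nonneg (by exact_mod_cast hH1)
    have hpow : (H : ℝ) ^ K = Real.exp (K * Real.log H) := by
      rw [Real.exp_nat_mul, Real.exp_log hHpos]
    rw [hpow, ← Real.exp_add]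
    refine Real.one_le_exp ?_
    have hKc : c₂ * d ≤ K := Nat.le_ceil _
    nlinarith [mul_le_mul_of_nonneg_right hKc hlogH]
  rw [← hHR]
  calc Real.exp (-(c₂ * (d : ℝ) ^ 1 * E))
      = Real.exp (-(c₂ * (d : ℝ) ^ 1 * E)) * 1 := (mul_one _).symm
    _ ≤ Real.exp (-(c₂ * (d : ℝ) ^ 1 * E)) * ((H : ℝ) ^ K * Real.exp (-(c₂ * d * Real.log H))) :=
        mul_le_mul_of_nonneg_left hHK (Real.exp_pos _).le
    _ = (H : ℝ) ^ K * (Real.exp (-(c₂ * (d : ℝ) ^ 1 * E)) * Real.exp (-(c₂ * d * Real.log H))) := by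
        ring
    _ ≤ (H : ℝ) ^ K * ‖∑ i, (h i : ℂ) * Complex.exp β ^ (i : ℕ)‖ :=
        mul_le_mul_of_nonneg_left hmain (pow_nonneg hHpos.le _)

end ExpAlgPowers

/-! ## The registered stub C17 -/

/-- **Registered stub `stub_expAlgPowersTH` of line `sector-split`** (calibration C17, signature
verbatim): for every non-zero algebraic `β`, the powers `1, e^β, …, e^{(d−1)β}` of `e^β` satisfy the
Technical Hypothesis of Nesterenko–Philippon, LNM 1752, Ch. 14, Definition 2.6.  Proof: Ably's measure
(`ExpAlgPowers.norm_linearForm_exp_pow_lowerBound`) is a polynomial lower bound, and a polynomial lower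
bound implies (T.H.) (`TechnicalHypothesis.of_lowerBound`).
[cite: Ably1994, Théorème p. 30] [cite: NesterenkoPhilippon2001, Ch. 14 Def. 2.6] -/
theorem stub_expAlgPowersTH :
    ∀ β : ℂ, IsAlgebraic ℚ β → β ≠ 0 → ∀ d : ℕ,
      Literature.Barriers.Schanuel.TechnicalHypothesis (fun i : Fin d => (Complex.exp β) ^ (i : ℕ)) := by
  intro β hβ hβ0 d
  obtain ⟨c, hc, k, hb⟩ := ExpAlgPowers.norm_linearForm_exp_pow_lowerBound hβ hβ0 d
  exact (Literature.Barriers.Schanuel.technicalHypothesis_iff_transcendental _).mpr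
    (Literature.NumberTheory.Transcendental.TechnicalHypothesis.of_lowerBound hc (k := k) hb)

namespace ExpAlgPowers

/-! ### The grid `(e^{iβ}) × (e^{jβ})` -/

/-- `e^β` is transcendental for `β ≠ 0` algebraic (Hermite–Lindemann, tree `transcendental_exp_holds`).
[cite: BakerTNT1975, Ch. 1 Thm 1.4] -/
theorem transcendental_exp {β : ℂ} (hβ : IsAlgebraic ℚ β) (hβ0 : β ≠ 0) :
    Transcendental ℚ (Complex.exp β) :=
  Literature.NumberTheory.Transcendental.transcendental_exp_holds hβ hβ0

/-- The powers `1, e^β, …, e^{(N−1)β}` are `ℚ`-linearly independent for `β ≠ 0` algebraic (`e^β` is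
transcendental, so no non-zero rational polynomial vanishes at it). [cite: BakerTNT1975, Ch. 1 Thm 1.4] -/
theorem linearIndependent_exp_pow {β : ℂ} (hβ : IsAlgebraic ℚ β) (hβ0 : β ≠ 0) (N : ℕ) :
    LinearIndependent ℚ (fun k : Fin N => (Complex.exp β) ^ (k : ℕ)) := by
  rw [Fintype.linearIndependent_iff]
  intro g hg l
  set p : Polynomial ℚ := ∑ i : Fin N, Polynomial.monomial (i : ℕ) (g i) with hp
  have hpt : Polynomial.aeval (Complex.exp β) p = 0 := by
    simp only [hp, map_sum, Polynomial.aeval_monomial, ← Algebra.smul_def]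
    exact hg
  have hp0 : p = 0 := by
    by_contra hne
    exact transcendental_exp hβ hβ0 ⟨p, hne, hpt⟩
  have hcoeff : p.coeff (l : ℕ) = g l := by
    simp only [hp, Polynomial.finsetSum_coeff, Polynomial.coeff_monomial]
    rw [Finset.sum_eq_single l]
    · simp
    · intro b _ hb
      rw [if_neg]
      exact fun h => hb (Fin.ext h)
    · intro h; exact absurd (Finset.mem_univ l) h
  rw [← hcoeff, hp0, Polynomial.coeff_zero]

/-- The grid field `gridField₂ x y`, `x = (uⁱ)_{i<d}`, `y = (uʲ)_{j<ℓ}`, lies in the explicit field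
`ℚ(u, exp(u^k) : k < d + ℓ − 1)` when `d + ℓ < dℓ`: the generators are powers of `u` and the
`exp(uⁱuʲ) = exp(u^{i+j})`, `i + j ≤ d + ℓ − 2`. [folklore] -/
theorem gridField₂_le_explicit (u : ℂ) {d l : ℕ} (hdl : l + d < d * l) :
    Literature.Barriers.Schanuel.gridField₂ (fun i : Fin d => u ^ (i : ℕ)) (fun j : Fin l => u ^ (j : ℕ)) ≤
      IntermediateField.adjoin ℚ ({u} ∪ Set.range (fun k : Fin (d + l - 1) => Complex.exp (u ^ (k : ℕ)))) := by
  obtain ⟨hd1, hl1⟩ := Literature.Barriers.Schanuel.one_le_of_add_lt_mul hdl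
  set E := IntermediateField.adjoin ℚ ({u} ∪ Set.range (fun k : Fin (d + l - 1) => Complex.exp (u ^ (k : ℕ))))
    with hE
  have huE : u ∈ E := IntermediateField.subset_adjoin _ _ (Set.mem_union_left _ rfl)
  rw [Literature.Barriers.Schanuel.gridField₂]
  refine IntermediateField.adjoin_le_iff.mpr ?_
  rintro z ((⟨i, rfl⟩ | ⟨j, rfl⟩) | ⟨p, rfl⟩)
  · exact pow_mem huE _
  · exact pow_mem huE _
  · have hlt : (p.1 : ℕ) + (p.2 : ℕ) < d + l - 1 := by
      have h1 := p.1.is_lt; have h2 := p.2.is_lt; omega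
    refine IntermediateField.subset_adjoin _ _ (Set.mem_union_right _ ⟨⟨_, hlt⟩, ?_⟩)
    simp [pow_add]

end ExpAlgPowers

/-! ## The registered stub C18: Diaz's Theorem 2.7 on the `e^β`-power grid, unconditionally -/

/-- **Registered stub `stub_expAlgGridBound` of line `sector-split`** (calibration C18, signature
verbatim) — Diaz's Theorem 2.7, clause `t₂` (LNM 1752, Ch. 14, Thm 2.7; PROVED in the tree as
`Literature.Barriers.Schanuel.ceil_le_trdeg_gridField₂`) made UNCONDITIONAL on the grid `x = (e^{iβ})_{i<d}`,
`y = (e^{jβ})_{j<ℓ}` for every non-zero algebraic `β`: for `d + ℓ < dℓ`,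
`⌈dℓ/(d+ℓ)⌉ ≤ trdeg_ℚ ℚ(e^β, exp(e^{kβ}) : k ≤ d + ℓ − 2)`.  Inputs: linear independence of the powers of
`e^β` (Hermite–Lindemann) and (T.H.) for them (`stub_expAlgPowersTH`, Ably).  Schanuel's conjecture
predicts `d + ℓ − 1`. [cite: NesterenkoPhilippon2001, Ch. 14 Thm 2.7 (t₂)] [cite: Ably1994, Théorème p. 30] -/
theorem stub_expAlgGridBound :
    ∀ β : ℂ, IsAlgebraic ℚ β → β ≠ 0 → ∀ d l : ℕ, l + d < d * l →
      ((⌈((d * l : ℕ) : ℚ) / ((l + d : ℕ) : ℚ)⌉₊ : ℕ) : Cardinal) ≤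
        Algebra.trdeg ℚ ↥(IntermediateField.adjoin ℚ ({Complex.exp β} ∪
          Set.range (fun k : Fin (d + l - 1) => Complex.exp ((Complex.exp β) ^ (k : ℕ))))) := by
  intro β hβ hβ0 d l h
  have hli := ExpAlgPowers.linearIndependent_exp_pow hβ hβ0
  exact (Literature.Barriers.Schanuel.ceil_le_trdeg_gridField₂ _ _ (hli d) (stub_expAlgPowersTH β hβ hβ0 d)
    (hli l) (stub_expAlgPowersTH β hβ hβ0 l) h).trans
      (Literature.Barriers.Schanuel.trdeg_mono (ExpAlgPowers.gridField₂_le_explicit _ h))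

namespace ExpAlgPowers

open Summit.Schanuel.Schanuel.Theorems.AclSubsetLogFreeCore.Negative

/-! ### Instances and the (R)-cells -/

/-- `(d, ℓ) = (4, 5)`: **for every non-zero algebraic `β`, three of `e^β, e, e^{e^β}, e^{e^{2β}}, …,
e^{e^{7β}}` are algebraically independent** (`⌈20/9⌉ = 3`; Lindemann–Weierstrass gives `e^β ⊥ e` only).
[cite: NesterenkoPhilippon2001, Ch. 14 Thm 2.7 (t₂)] -/
theorem three_le_trdeg_exp_exp_pow_eight {β : ℂ} (hβ : IsAlgebraic ℚ β) (hβ0 : β ≠ 0) :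
    ((3 : ℕ) : Cardinal) ≤ Algebra.trdeg ℚ ↥(IntermediateField.adjoin ℚ ({Complex.exp β} ∪
      Set.range (fun k : Fin 8 => Complex.exp ((Complex.exp β) ^ (k : ℕ))))) := by
  have h := stub_expAlgGridBound β hβ hβ0 4 5 (by norm_num)
  norm_num at h
  exact h

/-- `e^β ∈ C_EA` for `β` algebraic (`ℚ̄ ⊆ M ⊆ C_EA` and `C_EA` is `exp`-closed). [folklore] -/
theorem exp_mem_logFreeCore {β : ℂ} (hβ : IsAlgebraic ℚ β) : Complex.exp β ∈ logFreeCore :=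
  logFreeCore_mem_coreFamily.2.1 β
    (CalibrationB.kernelFreeCore_le_logFreeCore (mem_kernelFreeCore_of_isAlgebraic_rat hβ))

/-- **The `e^β`-power tuples as (R)-cells.**  For `β ≠ 0` algebraic and `d + ℓ < dℓ`,
`z = ((e^β)^k)_{k < d+ℓ−1} = (e^{kβ})_k` is a `ℚ`-free tuple of the log-free core (so (R) demands
`d + ℓ − 1` on it, `powers_demand_of_crux`), and unconditionally `⌈dℓ/(d+ℓ)⌉ ≤ trdeg ℚ(z, e^z)`.
[cite: NesterenkoPhilippon2001, Ch. 14 Thm 2.7 (t₂)] -/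
theorem cruxCell {β : ℂ} (hβ : IsAlgebraic ℚ β) (hβ0 : β ≠ 0) (d l : ℕ) (h : l + d < d * l) :
    (∀ k : Fin (d + l - 1), (Complex.exp β) ^ (k : ℕ) ∈ logFreeCore) ∧
    LinearIndependent ℚ (fun k : Fin (d + l - 1) => (Complex.exp β) ^ (k : ℕ)) ∧
    ((⌈((d * l : ℕ) : ℚ) / ((l + d : ℕ) : ℚ)⌉₊ : ℕ) : Cardinal) ≤ Algebra.trdeg ℚ
      ↥(IntermediateField.adjoin ℚ (Set.range (fun k : Fin (d + l - 1) => (Complex.exp β) ^ (k : ℕ)) ∪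
        Set.range (Complex.exp ∘ fun k : Fin (d + l - 1) => (Complex.exp β) ^ (k : ℕ)))) := by
  refine ⟨fun _ => pow_mem (exp_mem_logFreeCore hβ) _,
    linearIndependent_exp_pow hβ hβ0 _,
    (stub_expAlgGridBound β hβ hβ0 d l h).trans (Literature.Barriers.Schanuel.trdeg_mono ?_)⟩
  have h1 : 1 < d + l - 1 := by
    have hd : 2 ≤ d := by
      by_contra hd
      interval_cases d <;> omega
    have hl : 2 ≤ l := by
      by_contra hl
      interval_cases l <;> omega
    omega
  exact IntermediateField.adjoin.mono _ _ _ (by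
    rintro z (rfl | ⟨k, rfl⟩)
    · exact Set.mem_union_left _ ⟨⟨1, h1⟩, by simp⟩
    · exact Set.mem_union_right _ ⟨k, rfl⟩)

/-- The demand side, by the crux's name: (R) ⟹ `N ≤ trdeg ℚ(z_N, e^{z_N})` for `z_N = (e^{kβ})_{k<N}`,
every non-zero algebraic `β`. -/
theorem powers_demand_of_crux (hR : Summit.Schanuel.Schanuel.Theses.RigidCore.SchanuelOnLogFreeCore)
    {β : ℂ} (hβ : IsAlgebraic ℚ β) (hβ0 : β ≠ 0) (N : ℕ) :
    (N : Cardinal) ≤ Algebra.trdeg ℚ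
      ↥(IntermediateField.adjoin ℚ (Set.range (fun k : Fin N => (Complex.exp β) ^ (k : ℕ)) ∪
        Set.range (Complex.exp ∘ fun k : Fin N => (Complex.exp β) ^ (k : ℕ)))) :=
  hR N _ (fun _ => pow_mem (exp_mem_logFreeCore hβ) _)
    (linearIndependent_exp_pow hβ hβ0 N)

end ExpAlgPowers

end Summit.Schanuel.Schanuel.Theorems.RigidCore

end
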